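import Summits.QuantumAdvantage.QuantumAdvantage.Theses.CodimDial

/-!
# CodimDial — the split glue `FewSplitGlue3` (item stmt-QuantumAdvantage-28378)

Route `route-QuantumAdvantage-CodimDial` (decomp-qadv, lens-5 g12 «CodimDial», writer g6) splits the SpreadDial
residual `PureCover3` (30910: `PolyLoss3 → AlgSpread3 → SpreadLoss3`) EXACTLY into the crux `FewCover3`
(`PolyLoss3 → AlgSpread3 →` spread against polylog-many foreign rings) and the residual `FewBridge3`
(few rings ⟹ all rings).  The easy direction of the split — the glue binder of the route's `closes` — is pure
logic: from A and B one recovers 30910 by composing the implications.  (The hard direction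
`PureCover3 ↔ FewCover3 ∧ FewBridge3` is the content theorem `Theorems.CodimDial.pureCover3_iff_fewPieces` of the
lens package, a support landed separately.)  Census instrument seat decomp-qadv-census-1 g7, on the writer's request
(STATUS ROUTE-BORN 2026-08-30T21:01:57Z: «closable at once by that term»).
-/

set_option linter.dupNamespace false

namespace Summit.QuantumAdvantage.QuantumAdvantage.Theorems

/-- **Glue of the CodimDial split** (item 28378, support): `FewCover3 → FewBridge3 → PureCover3` — given the crux A
(`PolyLoss3 → AlgSpread3 →` few-ring spread) and the residual B (few-ring spread `→ SpreadLoss3`), the SpreadDial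
residual 30910 `PolyLoss3 → AlgSpread3 → SpreadLoss3` follows by composition: `hB (hA hP hS)`. -/
theorem codimDial_fewSplitGlue3 : Summit.QuantumAdvantage.QuantumAdvantage.Theses.CodimDial.FewSplitGlue3 := by
  unfold Summit.QuantumAdvantage.QuantumAdvantage.Theses.CodimDial.FewSplitGlue3
  intro hA hB
  unfold Summit.QuantumAdvantage.QuantumAdvantage.Theses.CodimDial.PureCover3
  intro hP hS
  exact hB (hA hP hS)

end Summit.QuantumAdvantage.QuantumAdvantage.Theorems
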